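import Summits.KontsevichZagierPeriods.KontsevichZagierPeriods.Theorems.LinRedNormalFormArrangementNormalFormSeparateAllHHMonoSplit
import Summits.KontsevichZagierPeriods.KontsevichZagierPeriods.Theorems.LinRedNormalFormArrangementNormalFormSeparateThreeHHKOrder

/-!
# Free sweeps and the ray theorem on a nested sector of any depth

(Line `janus-bands`, crux `ArrangementNormalForm`, stub `stub_separateHigh_hH`, part `AllHHRay` of
the dimension-generic wall-invariant termwise-split lemma, base dimension `b + 1 ≥ 4` with fibres;
namespace `SepAll`.)
Abstract analytic core of the local analysis of the Taylor pieces on a nested thin sector of depth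
`n + 1` in blown-up coordinates `w ∈ box δ` (part `AllHHMonoSplit`). The weight `W ≥ 0` is
measurable, almost decreasing towards the corner at ratio `4` on the big box `box (4δ)` (constant
`K`), and has LOGARITHMIC CONTRACTION COSTS (`Kn`, `C`) in the FREE coordinates `i ∈ Free`:
`W w ≤ C (1 + log (x'/w i))^Kn · W (update w i x')` for `w i ≤ x'`.
* `reduce` / `reduce_finset`: integrability of `w^a · W` on the box survives zeroing the exponents of
  the free coordinates (`SepTwo.lintegral_le_pow_of_logmono` applied coordinatewise, Tonelli via
  `SepAll.lintegral_boxMeasure_peel'`);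
* `ray` (registered as `separateAllHH_ray`): if the TOTAL tensor polynomial `pevn c` is absolutely
  `W`-integrable on the big box and a PIECE `pevn c'` has the MATCHING PROPERTY — every exponent `e`
  in the support of `c'` admits an exponent `e'` in the support of `c` with `e' l ≤ e l` at every
  loaded (non-free) coordinate `l` — then the piece is absolutely `W`-integrable on the small box:
  the monomial split (`SepAll.monoSplit_lt_top`) integrates `w^{e'} W`, the free sweeps remove the
  free exponents, and `w^e ≤ B · w^{e' zeroed}` on the box.
-/

noncomputable section

open Set MeasureTheory Function
open scoped ENNReal

namespace Summit.KontsevichZagierPeriods.ArrangementNormalForm.JanusBands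

namespace SepAll

open SepTwo SepHHK

variable {n d : ℕ}

/-! ### Monomials and inserted coordinates -/

/-- A monomial at a point with an inserted coordinate. -/
theorem mono_insertNth (e : Fin (n + 1) → ℕ) (i : Fin (n + 1)) (x : ℝ) (w' : Fin n → ℝ) :
    mono e (i.insertNth x w') = x ^ e i * mono (fun j => e (i.succAbove j)) w' := by
  simp [mono, Fin.prod_univ_succAbove _ i, Fin.insertNth_apply_same, Fin.insertNth_apply_succAbove]

/-- A monomial with zeroed `i`-th exponent at a point with an inserted `i`-th coordinate. -/
theorem mono_update_insertNth (e : Fin (n + 1) → ℕ) (i : Fin (n + 1)) (x : ℝ) (w' : Fin n → ℝ) :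
    mono (update e i 0) (i.insertNth x w') = mono (fun j => e (i.succAbove j)) w' := by
  rw [mono_insertNth]
  simp

/-- Coordinates of a point with an inserted coordinate lie in a box. -/
theorem insertNth_bounds {δ : Fin (n + 1) → ℝ} {i : Fin (n + 1)} {x : ℝ} {w' : Fin n → ℝ}
    (hx : x ∈ Ioo 0 (δ i)) (hw' : w' ∈ box fun j => δ (i.succAbove j)) :
    ∀ l, 0 < (i.insertNth x w' : Fin (n + 1) → ℝ) l ∧ (i.insertNth x w' : Fin (n + 1) → ℝ) l < δ l := by
  refine i.forall_iff_succAbove.2 ⟨?_, fun j => ?_⟩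
  · simpa using hx
  · simpa using mem_box.1 hw' j

/-! ### Free sweeps -/

/-- **Sweep in one free coordinate.** If `W` has a logarithmic contraction cost in the coordinate
`i` on the box, then the integrability of `w^a · W` on the box survives zeroing the exponent `a i`. -/
theorem reduce (i : Fin (n + 1)) (W : (Fin (n + 1) → ℝ) → ℝ≥0∞) (hW : Measurable W) (Kn : ℕ)
    (C : ℝ≥0∞) (hC : C ≠ ∞) (δ : Fin (n + 1) → ℝ) (hδ : 0 < δ i)
    (hlog : ∀ w : Fin (n + 1) → ℝ, (∀ l, 0 < w l ∧ w l < δ l) → ∀ x', w i ≤ x' → x' < δ i →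
      W w ≤ C * ENNReal.ofReal ((1 + Real.log (x' / w i)) ^ Kn) * W (update w i x'))
    (a : Fin (n + 1) → ℕ) (hfin : ∫⁻ w in box δ, ENNReal.ofReal (mono a w) * W w < ∞) :
    ∫⁻ w in box δ, ENNReal.ofReal (mono (update a i 0) w) * W w < ∞ := by
  have hA := ordC_ne_top hC Kn (δ i) (a i)
  have hF₁ : Measurable fun w : Fin (n + 1) → ℝ => ENNReal.ofReal (mono (update a i 0) w) * W w :=
    (ENNReal.measurable_ofReal.comp (continuous_mono _).measurable).mul hW
  have hF₂ : Measurable fun w : Fin (n + 1) → ℝ => ENNReal.ofReal (mono a w) * W w :=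
    (ENNReal.measurable_ofReal.comp (continuous_mono _).measurable).mul hW
  rw [restrict_box, lintegral_boxMeasure_peel' i δ _ hF₂] at hfin
  rw [restrict_box, lintegral_boxMeasure_peel' i δ _ hF₁]
  have hins : ∀ w' : Fin n → ℝ, Measurable fun x : ℝ => W (i.insertNth x w') := fun w' =>
    hW.comp ((measurable_insertNth i).comp (measurable_id.prodMk measurable_const))
  -- pointwise in the remaining coordinates
  have key : ∀ w' ∈ box (fun j => δ (i.succAbove j)),
      ∫⁻ x in Ioo 0 (δ i), ENNReal.ofReal (mono (update a i 0) (i.insertNth x w')) *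
          W (i.insertNth x w') ≤
        ordC C Kn (δ i) (a i) * ∫⁻ x in Ioo 0 (δ i), ENNReal.ofReal (mono a (i.insertNth x w')) *
          W (i.insertNth x w') := by
    intro w' hw'
    have h1 : ∫⁻ x in Ioo 0 (δ i), W (i.insertNth x w') ≤ ordC C Kn (δ i) (a i) *
        ∫⁻ x in Ioo 0 (δ i), ENNReal.ofReal (x ^ a i) * W (i.insertNth x w') := by
      refine lintegral_le_pow_of_logmono (fun x => W (i.insertNth x w')) (hins w') Kn C hδ
        (fun x x' hx hxx' hx' => ?_) (a i)
      have h := hlog (i.insertNth x w') (insertNth_bounds ⟨hx, lt_of_le_of_lt hxx' hx'⟩ hw') x'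
        (by simpa using hxx') hx'
      simpa using h
    have hM : 0 ≤ mono (fun j => a (i.succAbove j)) w' :=
      mono_nonneg _ fun j => (mem_box.1 hw' j).1.le
    have hm2 : Measurable fun x : ℝ => ENNReal.ofReal (x ^ a i) * W (i.insertNth x w') :=
      (ENNReal.measurable_ofReal.comp (measurable_id.pow_const _)).mul (hins w')
    simp_rw [mono_update_insertNth, mono_insertNth]
    calc ∫⁻ x in Ioo 0 (δ i), ENNReal.ofReal (mono (fun j => a (i.succAbove j)) w') * W (i.insertNth x w')
        = ENNReal.ofReal (mono (fun j => a (i.succAbove j)) w') *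
            ∫⁻ x in Ioo 0 (δ i), W (i.insertNth x w') := lintegral_const_mul _ (hins w')
      _ ≤ ENNReal.ofReal (mono (fun j => a (i.succAbove j)) w') * (ordC C Kn (δ i) (a i) *
            ∫⁻ x in Ioo 0 (δ i), ENNReal.ofReal (x ^ a i) * W (i.insertNth x w')) :=
          mul_le_mul_right h1 _
      _ = ordC C Kn (δ i) (a i) * ∫⁻ x in Ioo 0 (δ i),
            ENNReal.ofReal (x ^ a i * mono (fun j => a (i.succAbove j)) w') * W (i.insertNth x w') := by
          rw [mul_left_comm, ← lintegral_const_mul _ hm2]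
          congr 1
          refine lintegral_congr fun x => ?_
          rw [← mul_assoc, ← ENNReal.ofReal_mul hM, mul_comm (mono _ w')]
  calc ∫⁻ w', (∫⁻ x in Ioo 0 (δ i), ENNReal.ofReal (mono (update a i 0) (i.insertNth x w')) *
          W (i.insertNth x w')) ∂boxMeasure (fun j => δ (i.succAbove j))
      ≤ ∫⁻ w', ordC C Kn (δ i) (a i) * (∫⁻ x in Ioo 0 (δ i),
          ENNReal.ofReal (mono a (i.insertNth x w')) * W (i.insertNth x w'))
          ∂boxMeasure (fun j => δ (i.succAbove j)) := by
        rw [← restrict_box]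
        exact setLIntegral_mono' (measurableSet_box _) key
    _ = ordC C Kn (δ i) (a i) * ∫⁻ w', (∫⁻ x in Ioo 0 (δ i),
          ENNReal.ofReal (mono a (i.insertNth x w')) * W (i.insertNth x w'))
          ∂boxMeasure (fun j => δ (i.succAbove j)) := lintegral_const_mul' _ _ hA
    _ < ∞ := ENNReal.mul_lt_top hA.lt_top hfin

/-- **Sweeps in all free coordinates.** -/
theorem reduce_finset (Free : Finset (Fin (n + 1))) (W : (Fin (n + 1) → ℝ) → ℝ≥0∞)
    (hW : Measurable W) (Kn : ℕ) (C : ℝ≥0∞) (hC : C ≠ ∞) (δ : Fin (n + 1) → ℝ)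
    (hδ : ∀ l, 0 < δ l)
    (hlog : ∀ i ∈ Free, ∀ w : Fin (n + 1) → ℝ, (∀ l, 0 < w l ∧ w l < δ l) → ∀ x', w i ≤ x' →
      x' < δ i → W w ≤ C * ENNReal.ofReal ((1 + Real.log (x' / w i)) ^ Kn) * W (update w i x'))
    (a : Fin (n + 1) → ℕ) (hfin : ∫⁻ w in box δ, ENNReal.ofReal (mono a w) * W w < ∞) :
    ∫⁻ w in box δ, ENNReal.ofReal (mono (fun l => if l ∈ Free then 0 else a l) w) * W w < ∞ := by
  classical
  induction Free using Finset.induction_on with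
  | empty => simpa using hfin
  | insert i S hi ih =>
    have hS := ih (fun i' hi' => hlog i' (Finset.mem_insert_of_mem hi'))
    have heq : (fun l => if l ∈ insert i S then 0 else a l) =
        update (fun l => if l ∈ S then 0 else a l) i 0 := by
      funext l
      by_cases hl : l = i
      · subst hl; simp
      · simp [hl]
    rw [heq]
    exact reduce i W hW Kn C hC δ (hδ i) (hlog i (Finset.mem_insert_self i S)) _ hS

/-! ### The ray theorem -/

/-- Comparison of monomials with comparable exponents on a box. -/
theorem mono_le_of_le {e e' : Fin n → ℕ} (h : ∀ l, e' l ≤ e l) {δ w : Fin n → ℝ}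
    (hw : ∀ l, 0 < w l ∧ w l < δ l) :
    mono e w ≤ (∏ l, max (δ l) 1 ^ (e l - e' l)) * mono e' w := by
  unfold mono
  rw [← Finset.prod_mul_distrib]
  refine Finset.prod_le_prod (fun l _ => pow_nonneg (hw l).1.le _) fun l _ => ?_
  have h1 : w l ^ e l = w l ^ (e l - e' l) * w l ^ e' l := by
    rw [← pow_add, Nat.sub_add_cancel (h l)]
  rw [h1]
  refine mul_le_mul_of_nonneg_right ?_ (pow_nonneg (hw l).1.le _)
  exact pow_le_pow_left₀ (hw l).1.le ((hw l).2.le.trans (le_max_left _ _)) _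

/-- **The ray theorem on a nested sector of any depth.** See the module docstring. -/
theorem ray (W : (Fin (n + 1) → ℝ) → ℝ≥0∞) (hW : Measurable W) (K : ℝ≥0∞) (hK : K ≠ ∞)
    (Kn : ℕ) (C : ℝ≥0∞) (hC : C ≠ ∞) (δ : Fin (n + 1) → ℝ) (hδ : ∀ l, 0 < δ l)
    (Free : Finset (Fin (n + 1)))
    (hmono : ∀ w w' : Fin (n + 1) → ℝ, (∀ l, 0 < w l) → (∀ l, w l ≤ w' l) →
      (∀ l, w' l ≤ 4 * w l) → (∀ l, w' l < 4 * δ l) → W w ≤ K * W w')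
    (hlog : ∀ i ∈ Free, ∀ w : Fin (n + 1) → ℝ, (∀ l, 0 < w l ∧ w l < δ l) → ∀ x', w i ≤ x' →
      x' < δ i → W w ≤ C * ENNReal.ofReal ((1 + Real.log (x' / w i)) ^ Kn) * W (update w i x'))
    (c : (Fin (n + 1) → Fin (d + 1)) → ℝ)
    (hfin : ∫⁻ w in box (fun l => 4 * δ l), ENNReal.ofReal |pevn c w| * W w < ∞)
    (c' : (Fin (n + 1) → Fin (d + 1)) → ℝ)
    (hmatch : ∀ e, c' e ≠ 0 → ∃ e', c e' ≠ 0 ∧ ∀ l, l ∉ Free → (e' l : ℕ) ≤ e l) :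
    ∫⁻ w in box δ, ENNReal.ofReal |pevn c' w| * W w < ∞ := by
  classical
  -- termwise bound
  have hterm : ∀ e : Fin (n + 1) → Fin (d + 1),
      ∫⁻ w in box δ, ENNReal.ofReal (|c' e| * mono (fun l => (e l : ℕ)) w) * W w < ∞ := by
    intro e
    by_cases hce : c' e = 0
    · simp [hce]
    obtain ⟨e', hce', hle⟩ := hmatch e hce
    -- the monomial `e'` of the total is integrable
    have h1 := monoSplit_lt_top c W hW K hK δ hmono hfin e'
    have h2 : ∫⁻ w in box δ, ENNReal.ofReal (mono (fun l => (e' l : ℕ)) w) * W w < ∞ := by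
      have hpos : ENNReal.ofReal |c e'| ≠ 0 := by
        rw [ENNReal.ofReal_ne_zero_iff]; exact abs_pos.2 hce'
      have hm : Measurable fun w : Fin (n + 1) → ℝ =>
          ENNReal.ofReal (mono (fun l => (e' l : ℕ)) w) * W w :=
        (ENNReal.measurable_ofReal.comp (continuous_mono _).measurable).mul hW
      have h3 : ∫⁻ w in box δ, ENNReal.ofReal (|c e'| * mono (fun l => (e' l : ℕ)) w) * W w =
          ENNReal.ofReal |c e'| * ∫⁻ w in box δ, ENNReal.ofReal (mono (fun l => (e' l : ℕ)) w) * W w := by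
        rw [← lintegral_const_mul _ hm]
        refine lintegral_congr fun w => ?_
        rw [ENNReal.ofReal_mul (abs_nonneg _), mul_assoc]
      rw [h3] at h1
      exact (ENNReal.mul_lt_top_iff.1 h1).elim (fun h => h.2)
        (fun h => h.elim (fun h => absurd h hpos) (fun h => by simp [h]))
    -- sweep the free coordinates
    have h4 := reduce_finset Free W hW Kn C hC δ hδ hlog _ h2
    -- compare the monomials
    set z : Fin (n + 1) → ℕ := fun l => if l ∈ Free then 0 else (e' l : ℕ) with hz
    have hzle : ∀ l, z l ≤ (e l : ℕ) := by
      intro l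
      simp only [hz]
      split_ifs with hl
      · exact Nat.zero_le _
      · exact hle l hl
    set B : ℝ := ∏ l, max (δ l) 1 ^ ((e l : ℕ) - z l) with hB
    have hB0 : 0 ≤ B := Finset.prod_nonneg fun l _ => pow_nonneg (le_max_of_le_right zero_le_one) _
    have hmz : Measurable fun w : Fin (n + 1) → ℝ => ENNReal.ofReal (mono z w) * W w :=
      (ENNReal.measurable_ofReal.comp (continuous_mono _).measurable).mul hW
    calc ∫⁻ w in box δ, ENNReal.ofReal (|c' e| * mono (fun l => (e l : ℕ)) w) * W w
        ≤ ∫⁻ w in box δ, ENNReal.ofReal (|c' e| * B) * (ENNReal.ofReal (mono z w) * W w) := by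
          refine setLIntegral_mono' (measurableSet_box _) fun w hw => ?_
          rw [← mul_assoc, ← ENNReal.ofReal_mul (mul_nonneg (abs_nonneg _) hB0)]
          refine mul_le_mul_left (ENNReal.ofReal_le_ofReal ?_) _
          rw [mul_assoc]
          exact mul_le_mul_of_nonneg_left (mono_le_of_le hzle (mem_box.1 hw)) (abs_nonneg _)
      _ = ENNReal.ofReal (|c' e| * B) * ∫⁻ w in box δ, ENNReal.ofReal (mono z w) * W w :=
          lintegral_const_mul _ hmz
      _ < ∞ := ENNReal.mul_lt_top ENNReal.ofReal_lt_top h4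
  -- sum over the support
  have hmeas : ∀ e : Fin (n + 1) → Fin (d + 1), Measurable fun w : Fin (n + 1) → ℝ =>
      ENNReal.ofReal (|c' e| * mono (fun l => (e l : ℕ)) w) * W w := fun e =>
    (ENNReal.measurable_ofReal.comp (continuous_const.mul (continuous_mono _)).measurable).mul hW
  calc ∫⁻ w in box δ, ENNReal.ofReal |pevn c' w| * W w
      ≤ ∫⁻ w in box δ, ∑ e, ENNReal.ofReal (|c' e| * mono (fun l => (e l : ℕ)) w) * W w := by
        refine setLIntegral_mono' (measurableSet_box _) fun w hw => ?_
        rw [← Finset.sum_mul]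
        refine mul_le_mul_left ?_ _
        have hnn : ∀ e : Fin (n + 1) → Fin (d + 1), 0 ≤ |c' e| * mono (fun l => (e l : ℕ)) w :=
          fun e => mul_nonneg (abs_nonneg _) (mono_nonneg _ fun l => (mem_box.1 hw l).1.le)
        rw [← ENNReal.ofReal_sum_of_nonneg fun e _ => hnn e]
        refine ENNReal.ofReal_le_ofReal ?_
        unfold pevn
        refine (Finset.abs_sum_le_sum_abs _ _).trans (Finset.sum_le_sum fun e _ => ?_)
        rw [abs_mul, abs_of_nonneg (mono_nonneg _ fun l => (mem_box.1 hw l).1.le)]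
    _ = ∑ e, ∫⁻ w in box δ, ENNReal.ofReal (|c' e| * mono (fun l => (e l : ℕ)) w) * W w :=
        lintegral_finsetSum _ fun e _ => hmeas e
    _ < ∞ := ENNReal.sum_lt_top.2 fun e _ => hterm e

end SepAll

/-- **The ray theorem on a nested sector of any depth** (registered part of `stub_separateHigh_hH`;
literal form of `SepAll.ray`): for a measurable weight `W` on `∏ (0, 4δ l)`, almost decreasing
towards the corner at ratio `4` (constant `K < ∞`) and with logarithmic contraction costs
(`Kn`, `C < ∞`) in the free coordinates `Free` on `∏ (0, δ l)`, if the total tensor polynomial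
`∑ c e ∏ w_l^{e l}` is absolutely `W`-integrable on the big box and every exponent of the piece `c'`
is matched by an exponent of `c` that is not larger at the loaded coordinates, then the piece
`∑ c' e ∏ w_l^{e l}` is absolutely `W`-integrable on `∏ (0, δ l)`. -/
theorem separateAllHH_ray (n d : ℕ) (W : (Fin (n + 1) → ℝ) → ENNReal) (hW : Measurable W) (K : ENNReal) (hK : K ≠ ⊤) (Kn : ℕ) (C : ENNReal) (hC : C ≠ ⊤) (δ : Fin (n + 1) → ℝ) (hδ : ∀ l, 0 < δ l) (Free : Finset (Fin (n + 1))) (hmono : ∀ w w' : Fin (n + 1) → ℝ, (∀ l, 0 < w l) → (∀ l, w l ≤ w' l) → (∀ l, w' l ≤ 4 * w l) → (∀ l, w' l < 4 * δ l) → W w ≤ K * W w') (hlog : ∀ i ∈ Free, ∀ w : Fin (n + 1) → ℝ, (∀ l, 0 < w l ∧ w l < δ l) → ∀ x', w i ≤ x' → x' < δ i → W w ≤ C * ENNReal.ofReal ((1 + Real.log (x' / w i)) ^ Kn) * W (Function.update w i x')) (c : (Fin (n + 1) → Fin (d + 1)) → ℝ) (hfin : MeasureTheory.lintegral (MeasureTheory.volume.restrict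 (Set.univ.pi fun l => Set.Ioo 0 (4 * δ l))) (fun w => ENNReal.ofReal |∑ e : Fin (n + 1) → Fin (d + 1), c e * ∏ l, w l ^ (e l : ℕ)| * W w) < ⊤) (c' : (Fin (n + 1) → Fin (d + 1)) → ℝ) (hmatch : ∀ e, c' e ≠ 0 → ∃ e', c e' ≠ 0 ∧ ∀ l, l ∉ Free → (e' l : ℕ) ≤ e l) : MeasureTheory.lintegral (MeasureTheory.volume.restrict (Set.univ.pi fun l => Set.Ioo 0 (δ l))) (fun w => ENNReal.ofReal |∑ e : Fin (n + 1) → Fin (d + 1), c' e * ∏ l, w l ^ (e l : ℕ)| * W w) < ⊤ := by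
  exact SepAll.ray W hW K hK Kn C hC δ hδ Free hmono hlog c hfin c' hmatch

end Summit.KontsevichZagierPeriods.ArrangementNormalForm.JanusBands
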